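import Summits.CriticalPhenomena.SAWScalingLimit.Theorems.SAWDevelopingMapHexTightSumRuleDefs
import Literature.Probability.RandomPlanarGeometry.HexParafermionSpinShift

/-!
# The lever `stub_signedVisitingBound` of the line `differentiated-sum-rule` (crux `HexTight`)

Crux `stmt-CriticalPhenomena-5423`
(`Summit.CriticalPhenomena.SAWScalingLimit.Theses.SAWDevelopingMap.HexTight`), line
`differentiated-sum-rule`, registered stub `stub_signedVisitingBound` (`= SignedVisitingBound` of
the checked skeleton `Cruxes/HexTight/Lines/differentiated-sum-rule.lean`, unfolded), over the
objects of `…Theorems.SAWDevelopingMapHexTightSumRuleDefs` (`xc`, `zmass`, `Visits`,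
`signedVisitMass`, `mainSigned`, `doorMass`, `wallMass`). Landed from seat c1 of the crux.

**Statement (strong-Markov identity for the Duminil-Copin–Smirnov parafermionic observable, real
part).** For a simply connected `Λ`, `U ⊆ Λ`, a boundary source `a = s(u, v)` (`u ∼ v`, `v ∈ Λ ∖ U`,
`u ∉ Λ`) and a phase `φ`: `Σ_{exits s(y,w) of Λ∖U leaving Λ} Σ_{γ ⊂ Λ : a → s(y,w), γ visits U}
cos((3/8)W_γ − φ) x_c^ℓ(γ) ≤ doorMass Λ U a + wallMass Λ U a`. **Proof.**
1. `satisfiesVertexRelations_of_subset`: DCS Lemma 1 (`(p−v)F(p) + (q−v)F(q) + (r−v)F(r) = 0` at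
   `x = x_c`, `σ = 5/8`) holds for the observable of EVERY sub-domain `Λ' ⊆ Λ` of a simply
   connected `Λ` rooted at a boundary mid-edge `{u, w₁}` of `Λ` with `w₁ ∈ Λ'`: the tree's proof
   of `DuminilCopinSmirnov2012_lemma1_holds` uses simple connectivity only through
   `HV.wnd_eq_zero_of_simplyConnected` ("the entrance lies outside every cycle of `Φ(Λ)`"), and the
   cycles of `Φ(Λ')` are cycles of `Φ(Λ)`.
2. The discrete Green identity (`hexFlux_eq_zero_of_satisfiesVertexRelations`) for `F = F^Λ_a` on
   `Λ` and for `F' = F^{Λ∖U}_a` on `Λ ∖ U`, split along `Λ = (Λ ∖ U) ⊔ U` and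
   `∁(Λ ∖ U) = ∁Λ ⊔ U`, gives `MAIN(F) − MAIN(F') = DOOR(F') − WALL(F)` (`flux_identity`).
3. Walks of `Λ` with no vertex in `U` are exactly the walks of `Λ ∖ U`, with the same weight, so
   `F(h) − F'(h)` is the sum over the `U`-VISITING walks (`observable_sub_observable_sdiff`).
4. Per walk `γ : a → s(y, w)` (`w ∉ Λ`) the unit tangent turns by `e^{iW_γ}` from the first
   half-edge to the last: `e^{iW_γ}(c_v − c_u) = c_w − c_y` (`exp_winding_mul_dir`, telescoping
   `exp_winding_mul_I` of the tree), whence the MAIN term of `γ` is `d_a e^{i(3/8)W_γ} x_c^ℓ` with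
   `d_a = (c_v − c_u)/2` (`term_weight_eq`), i.e. `MAIN(F) − MAIN(F') = d_a · S`.
5. `mainSigned = Re(e^{−iφ} S) ≤ |S|` and `|d_a|·|S| ≤ |DOOR(F')| + |WALL(F)| ≤ |d_a|(doorMass +
   wallMass)` termwise by `|F(z)| ≤ Σ_γ x_c^ℓ` (`norm_hexParafermionicObservable_le`) and
   `|mid(s(y,w)) − c_y| = |d_a|` (all honeycomb edges have length `1/√3`).
-/

noncomputable section

open Literature.Probability.RandomPlanarGeometry Literature.Probability.RandomPlanarGeometry.SAW
  Literature.Probability.LatticeModels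
open Literature.Barriers.CriticalPhenomena
open scoped BigOperators Classical

namespace Summit.CriticalPhenomena.SAWScalingLimit.Theorems.HexTight.SumRule

/-! ### 1. Lemma 1 of Duminil-Copin–Smirnov on sub-domains of a simply connected domain -/

open Literature.Probability.RandomPlanarGeometry.SAW.HV in
/-- **DCS Lemma 1 for a sub-domain.** For a simply connected `Λ`, a sub-domain `Λ' ⊆ Λ`, and a
root `{u, w₁}` with `u ∉ Λ`, `u ∼ w₁`, `w₁ ∈ Λ'`, the critical observable of `Λ'` rooted at
`{u, w₁}` satisfies the vertex relation at every vertex of `Λ'` (holes in `Λ'` are allowed: the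
entrance lies outside every cycle of `Λ ⊇ Λ'`). The proof is that of
`DuminilCopinSmirnov2012_lemma1_holds` with `Λ'` in place of `Λ` except in the winding-number input. -/
theorem satisfiesVertexRelations_of_subset {Λ Λ' : Finset HexVertex}
    (hΛ : hexDomainSimplyConnected Λ) (hsub : Λ' ⊆ Λ) {u w₁ : HexVertex}
    (huw : hexGraph.Adj u w₁) (hu : u ∉ Λ) (hw₁ : w₁ ∈ Λ') :
    SatisfiesVertexRelations Λ'
      (hexParafermionicObservable Λ' s(u, w₁) hexCriticalFugacity (5 / 8)) := by
  intro v hv p q r hp hq hr hpq hqr hpr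
  have hu' : u ∉ Λ' := fun h => hu (hsub h)
  obtain ⟨Φ, α, β, hα, hΦu, hΦw, haff⟩ := exists_chart huw
  set V := Λ'.map Φ.toEquiv.toEmbedding with hV
  have hw : wOut ∉ V := by
    intro h
    obtain ⟨y, hy, hyu⟩ := Finset.mem_map.1 h
    change Φ y = wOut at hyu
    exact hu' (Φ.injective (hyu.trans hΦu.symm) ▸ hy)
  have hvV : Φ v ∈ V := Finset.mem_map_of_mem _ hv
  have hVsub : V ⊆ Λ.map Φ.toEquiv.toEmbedding := Finset.map_subset_map.2 hsub
  have key := vertex_relation_of_wnd hw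
    (fun c hc hcyc => wnd_eq_zero_of_simplyConnected hΛ hu hΦu c
      (fun x hx => hVsub (hc x hx)) hcyc) hvV
  -- expand the contributions over the three mid-edges
  have hp' : hvGraph.Adj (Φ v) (Φ p) := (Φ.map_rel_iff).2 hp
  have hq' : hvGraph.Adj (Φ v) (Φ q) := (Φ.map_rel_iff).2 hq
  have hr' : hvGraph.Adj (Φ v) (Φ r) := (Φ.map_rel_iff).2 hr
  rw [Finset.sum_congr rfl fun P hP => cv_eq_three (mem_midWalks_iff.1 hP) hp' hq' hr'
    (Φ.injective.ne hpq) (Φ.injective.ne hqr) (Φ.injective.ne hpr),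
    Finset.sum_add_distrib, Finset.sum_add_distrib] at key
  have ht : ∀ t, hexGraph.Adj v t →
      ∑ P ∈ midWalks V, (if finalDart P = (Φ v, Φ t) ∨ finalDart P = (Φ t, Φ v)
        then edir (Φ v) (Φ t) * pwt P else 0) =
      (2 * α) * (hexMidpoint s(v, t) - hexCenter v) *
        hexParafermionicObservable Λ' s(u, w₁) hexCriticalFugacity (5 / 8) s(v, t) := by
    intro t hvt
    rw [← Finset.sum_filter, ← Finset.mul_sum,
      ← hexParafermionicObservable_eq_sum_pwt rfl hu' hw₁ huw hΦu hΦw haff hα hvt hv, edir,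
      emb_sub, haff, haff, hexMidpoint_mk]
    ring
  rw [ht p hp, ht q hq, ht r hr] at key
  have h2α : (2 : ℂ) * α ≠ 0 := mul_ne_zero two_ne_zero hα
  refine mul_left_cancel₀ h2α ?_
  rw [mul_zero]; linear_combination key

/-! ### 2. The flux identity `MAIN(F) − MAIN(F') = DOOR(F') − WALL(F)` -/

/-- Splitting the boundary flux out of `Λ ∖ U` (`U ⊆ Λ`): a neighbour outside `Λ ∖ U` is either
outside `Λ` (a MAIN exit) or in `U` (a DOOR). -/
theorem hexFlux_sdiff_split {Λ U : Finset HexVertex} (hUΛ : U ⊆ Λ) (G : Sym2 HexVertex → ℂ) :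
    HexGreen.hexFlux (Λ \ U) G =
      (∑ y ∈ Λ \ U, ∑ w ∈ (HexGreen.nbrs y).filter (fun w => w ∉ Λ), HexKernel.term G y w) +
        ∑ y ∈ Λ \ U, ∑ w ∈ (HexGreen.nbrs y).filter (fun w => w ∈ U), HexKernel.term G y w := by
  rw [HexGreen.hexFlux, ← Finset.sum_add_distrib]
  refine Finset.sum_congr rfl fun y _ => ?_
  rw [← Finset.sum_filter_add_sum_filter_not _ (fun w => w ∉ Λ), Finset.filter_filter,
    Finset.filter_filter]
  congr 1
  · refine Finset.sum_congr (Finset.filter_congr fun w _ => ?_) fun _ _ => rfl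
    simp only [Finset.mem_sdiff, not_and, not_not]
    exact ⟨fun h => h.2, fun h => ⟨fun h' => absurd h' h, h⟩⟩
  · refine Finset.sum_congr (Finset.filter_congr fun w _ => ?_) fun _ _ => rfl
    simp only [Finset.mem_sdiff, not_and, not_not]
    exact ⟨fun h => h.1 h.2, fun h => ⟨fun _ => h, hUΛ h⟩⟩

/-- Splitting the boundary flux out of `Λ` along `Λ = (Λ ∖ U) ⊔ U`: MAIN exits plus WALLS. -/
theorem hexFlux_split {Λ U : Finset HexVertex} (hUΛ : U ⊆ Λ) (G : Sym2 HexVertex → ℂ) :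
    HexGreen.hexFlux Λ G =
      (∑ y ∈ Λ \ U, ∑ w ∈ (HexGreen.nbrs y).filter (fun w => w ∉ Λ), HexKernel.term G y w) +
        ∑ y ∈ U, ∑ w ∈ (HexGreen.nbrs y).filter (fun w => w ∉ Λ), HexKernel.term G y w := by
  rw [HexGreen.hexFlux, ← Finset.sum_sdiff hUΛ]

/-- **The strong-Markov flux identity.** If `F` satisfies the vertex relations on `Λ` and `F'`
those on `Λ ∖ U` (`U ⊆ Λ`), then `MAIN(F) − MAIN(F') = DOOR(F') − WALL(F)`. -/
theorem flux_identity {Λ U : Finset HexVertex} (hUΛ : U ⊆ Λ) {F F' : Sym2 HexVertex → ℂ}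
    (hF : SatisfiesVertexRelations Λ F) (hF' : SatisfiesVertexRelations (Λ \ U) F') :
    (∑ y ∈ Λ \ U, ∑ w ∈ (HexGreen.nbrs y).filter (fun w => w ∉ Λ), HexKernel.term F y w) -
        (∑ y ∈ Λ \ U, ∑ w ∈ (HexGreen.nbrs y).filter (fun w => w ∉ Λ), HexKernel.term F' y w) =
      (∑ y ∈ Λ \ U, ∑ w ∈ (HexGreen.nbrs y).filter (fun w => w ∈ U), HexKernel.term F' y w) -
        ∑ y ∈ U, ∑ w ∈ (HexGreen.nbrs y).filter (fun w => w ∉ Λ), HexKernel.term F y w := by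
  have h1 := hexFlux_eq_zero_of_satisfiesVertexRelations hF
  have h2 := hexFlux_eq_zero_of_satisfiesVertexRelations hF'
  rw [hexFlux_split hUΛ] at h1
  rw [hexFlux_sdiff_split hUΛ] at h2
  linear_combination h1 - h2

/-! ### 3. Walks avoiding `U` are the walks of `Λ ∖ U` -/

/-- **`F^Λ(z) − F^{Λ∖U}(z)` is the sum over the `U`-visiting walks of `Λ`.** The walks of `Λ ∖ U`
from `a` to `z` are, with the same weights, exactly the walks of `Λ` from `a` to `z` visiting no
vertex of `U` (provided `a` is a mid-edge of `Λ ∖ U`, which only matters for the trivial walk). -/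
theorem observable_sub_observable_sdiff {Λ U : Finset HexVertex} {a : Sym2 HexVertex}
    (ha : a ∈ hexDomainMidEdges (Λ \ U)) (x σ : ℝ) (z : Sym2 HexVertex) :
    hexParafermionicObservable Λ a x σ z - hexParafermionicObservable (Λ \ U) a x σ z =
      ∑ γ : HexMidEdgeSAW Λ a z, if Visits γ U then γ.weight x σ else 0 := by
  rw [sub_eq_iff_eq_add, hexParafermionicObservable, hexParafermionicObservable]
  have hsplit : ∑ γ : HexMidEdgeSAW Λ a z, γ.weight x σ =
      (∑ γ : HexMidEdgeSAW Λ a z, if Visits γ U then γ.weight x σ else 0) +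
        ∑ γ ∈ (Finset.univ : Finset (HexMidEdgeSAW Λ a z)).filter (fun γ => ¬ Visits γ U),
          γ.weight x σ := by
    rw [Finset.sum_filter, ← Finset.sum_add_distrib]
    refine Finset.sum_congr rfl fun γ _ => ?_
    split_ifs <;> simp
  rw [hsplit]
  congr 1
  symm
  refine Finset.sum_bij
    (fun γ' _ => (⟨γ'.verts, fun y hy => (Finset.mem_sdiff.1 (γ'.subset y hy)).1, γ'.nodup,
      γ'.isChain, γ'.head_mem, γ'.getLast_mem, γ'.eq_of_nil, γ'.edges_nodup,
      ⟨γ'.fst_mem.1, by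
        obtain ⟨y, hy, hyΛ⟩ := γ'.fst_mem.2
        exact ⟨y, hy, (Finset.mem_sdiff.1 hyΛ).1⟩⟩⟩ : HexMidEdgeSAW Λ a z))
    (fun γ' _ => ?_) (fun γ₁ _ γ₂ _ h => ?_) (fun γ hγ => ?_) (fun γ' _ => rfl)
  · -- the lift visits no vertex of `U`
    refine Finset.mem_filter.2 ⟨Finset.mem_univ _, ?_⟩
    rintro ⟨y, hy, hyU⟩
    exact (Finset.mem_sdiff.1 (γ'.subset y hy)).2 hyU
  · -- injective
    have h' := congrArg HexMidEdgeSAW.verts h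
    exact HexMidEdgeSAW.ext h'
  · -- surjective: restrict a non-visiting walk
    have hγ' : ¬ Visits γ U := (Finset.mem_filter.1 hγ).2
    refine ⟨⟨γ.verts, fun y hy => Finset.mem_sdiff.2 ⟨γ.subset y hy, fun hyU => hγ' ⟨y, hy, hyU⟩⟩,
      γ.nodup, γ.isChain, γ.head_mem, γ.getLast_mem, γ.eq_of_nil, γ.edges_nodup, ha⟩,
      Finset.mem_univ _, HexMidEdgeSAW.ext rfl⟩

/-! ### 4. The phase of the MAIN term of a walk -/

/-- **The unit tangent turns by `e^{iW}`.** For a walk `γ` of `Λ` from the root `{u, v}` (`u ∉ Λ`,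
so `γ` starts at `v` heading `c_v − c_u`) to a boundary mid-edge `{y, w}` with `w ∉ Λ` (so `γ`
ends at `y` heading `c_w − c_y`), `e^{iW(γ)} (c_v − c_u) = c_w − c_y`: all honeycomb edges have
the same length and the turning angles telescope (`exp_winding_mul_I`). -/
theorem exp_winding_mul_dir {Λ : Finset HexVertex} {u v y w : HexVertex}
    (huv : hexGraph.Adj u v) (hu : u ∉ Λ) (hyw : hexGraph.Adj y w) (hw : w ∉ Λ)
    (γ : HexMidEdgeSAW Λ s(u, v) s(y, w)) (hne : γ.verts ≠ []) :
    Complex.exp ((γ.winding : ℂ) * Complex.I) * (hexCenter v - hexCenter u) =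
      hexCenter w - hexCenter y := by
  have hcu : hexCenter v - hexCenter u ≠ 0 := sub_ne_zero.2 (hexCenter_ne_of_adj huv).symm
  have hcy : hexCenter w - hexCenter y ≠ 0 := sub_ne_zero.2 (hexCenter_ne_of_adj hyw).symm
  -- the walk starts at `v`
  have hhead := γ.head_eq rfl hu hne
  obtain ⟨x₀, rest, hx₀⟩ := List.exists_cons_of_ne_nil hne
  have hx₁ : x₀ = v := by rw [← hhead]; simp [hx₀]
  have hx : γ.verts = v :: rest := by rw [hx₀, hx₁]
  clear hx₀ hx₁
  -- consecutive points of the polyline are distinct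
  have hchain : List.IsChain (· ≠ ·)
      (hexMidpoint s(u, v) :: (γ.verts.map hexCenter ++ [hexMidpoint s(y, w)])) := by
    refine γ.map_chain_ne hyw hne (hexMidpoint s(u, v)) (fun x hx' => ?_)
    rw [hx] at hx'
    simp only [List.head?_cons, Option.some.injEq] at hx'
    subst hx'
    rw [hexMidpoint_mk]
    intro he
    apply hexCenter_ne_of_adj huv
    linear_combination (2 : ℂ) * he
  -- the walk ends at `y` (`w ∉ Λ`)
  obtain ⟨L₀, g, hLg⟩ : ∃ L₀ g, γ.verts = L₀ ++ [g] :=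
    ⟨_, _, (List.dropLast_append_getLast hne).symm⟩
  have hg : g = y := by
    have h1 : γ.verts.getLast hne = g := by simp [hLg]
    rcases γ.getLast_eq_or hne with h | h
    · rw [← h1, h]
    · exact absurd (h ▸ γ.subset _ (List.getLast_mem hne)) hw
  rw [hg] at hLg
  -- the last increment
  have hlast : lastStep (hexMidpoint s(u, v)) (hexCenter v)
      ((rest.map hexCenter) ++ [hexMidpoint s(y, w)]) = hexMidpoint s(y, w) - hexCenter y := by
    have hwr : v :: rest = L₀ ++ [y] := by rw [← hx, hLg]
    rcases L₀ with _ | ⟨y', L₁⟩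
    · simp only [List.nil_append, List.cons.injEq] at hwr
      obtain ⟨rfl, rfl⟩ := hwr
      simp [lastStep]
    · simp only [List.cons_append, List.cons.injEq] at hwr
      obtain ⟨rfl, rfl⟩ := hwr
      rw [List.map_append, List.map_cons, List.map_nil, List.append_assoc, List.singleton_append]
      exact lastStep_eq _ _ _ _ _
  have hexpW := exp_winding_mul_I ((rest.map hexCenter) ++ [hexMidpoint s(y, w)])
    (hexMidpoint s(u, v)) (hexCenter v) (by simpa [hx] using hchain)
  have hW : γ.winding = Literature.Probability.LatticeModels.winding (hexMidpoint s(u, v) ::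
      hexCenter v :: ((rest.map hexCenter) ++ [hexMidpoint s(y, w)])) := by
    rw [HexMidEdgeSAW.winding, HexMidEdgeSAW.points, hx]; rfl
  have hfirst : hexCenter v - hexMidpoint s(u, v) = (1 / 2 : ℂ) * (hexCenter v - hexCenter u) := by
    rw [hexMidpoint_mk]; ring
  have hlast' : hexMidpoint s(y, w) - hexCenter y = (1 / 2 : ℂ) * (hexCenter w - hexCenter y) := by
    rw [hexMidpoint_mk]; ring
  rw [hlast, hfirst, hlast'] at hexpW
  have hn : ∀ z : ℂ, ‖(1 / 2 : ℂ) * z‖ = (1 / 2 : ℝ) * ‖z‖ := fun z => by rw [norm_mul]; norm_num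
  rw [hn, hn, norm_hexCenter_sub_of_adj hyw, norm_hexCenter_sub_of_adj huv] at hexpW
  rw [hW, hexpW]
  have h3 : ((Real.sqrt 3)⁻¹ : ℂ) ≠ 0 := by exact_mod_cast inv_ne_zero (Real.sqrt_ne_zero'.2 (by norm_num))
  push_cast
  field_simp

/-- **The MAIN term of a walk.** For a nontrivial walk `γ` of `Λ` from `{u, v}` (`u ∉ Λ`) to the
boundary mid-edge `{y, w}` (`w ∉ Λ`): `(mid{y,w} − c_y) · e^{−i(5/8)W_γ} x_c^ℓ =
((c_v − c_u)/2) · e^{i(3/8)W_γ} x_c^ℓ`. -/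
theorem term_weight_eq {Λ : Finset HexVertex} {u v y w : HexVertex}
    (huv : hexGraph.Adj u v) (hu : u ∉ Λ) (hyw : hexGraph.Adj y w) (hw : w ∉ Λ)
    (γ : HexMidEdgeSAW Λ s(u, v) s(y, w)) (hne : γ.verts ≠ []) :
    (hexMidpoint s(y, w) - hexCenter y) * γ.weight xc (5 / 8) =
      (hexCenter v - hexCenter u) / 2 *
        (Complex.exp (Complex.I * (3 / 8 : ℂ) * (γ.winding : ℂ)) * (xc : ℂ) ^ γ.length) := by
  have hdir : hexMidpoint s(y, w) - hexCenter y =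
      Complex.exp ((γ.winding : ℂ) * Complex.I) * ((hexCenter v - hexCenter u) / 2) := by
    rw [← mul_div_assoc, exp_winding_mul_dir huv hu hyw hw γ hne, hexMidpoint_mk]
    ring
  have hexp : Complex.exp ((γ.winding : ℂ) * Complex.I) *
      Complex.exp (-Complex.I * ((5 / 8 : ℝ) : ℂ) * (γ.winding : ℂ)) =
      Complex.exp (Complex.I * (3 / 8 : ℂ) * (γ.winding : ℂ)) := by
    rw [← Complex.exp_add]; congr 1; push_cast; ring
  rw [hdir, HexMidEdgeSAW.weight, ← hexp]
  ring

/-! ### 5. The lever -/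

/-- Termwise bound for DOOR and WALL: `|(mid{y,w} − c_y) F^{Λ₀}_a(s(y,w))| ≤ (1/(2√3)) · Z_{Λ₀}(a → s(y,w))`
for `y ∼ w` (`norm_hexParafermionicObservable_le`; honeycomb edges have length `1/√3`). -/
theorem norm_term_le_zmass (Λ₀ : Finset HexVertex) (a : Sym2 HexVertex) {y w : HexVertex}
    (hyw : hexGraph.Adj y w) :
    ‖HexKernel.term (hexParafermionicObservable Λ₀ a xc (5 / 8)) y w‖ ≤
      (Real.sqrt 3)⁻¹ / 2 * zmass Λ₀ a s(y, w) := by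
  rw [HexKernel.term, norm_mul]
  have h1 : ‖hexMidpoint s(y, w) - hexCenter y‖ = (Real.sqrt 3)⁻¹ / 2 := by
    rw [hexMidpoint_mk, show (hexCenter y + hexCenter w) / 2 - hexCenter y =
      (hexCenter w - hexCenter y) / 2 by ring, norm_div, norm_hexCenter_sub_of_adj hyw]
    simp
  rw [h1]
  exact mul_le_mul_of_nonneg_left
    (norm_hexParafermionicObservable_le Λ₀ a hexCriticalFugacity_pos_lt_one.1.le _ _)
    (by positivity)

/-- **The lever — signed visiting bound (strong-Markov identity for the critical parafermionic
observable, real part).** For a simply connected honeycomb domain `Λ`, any `U ⊆ Λ`, a boundary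
source `a = s(u, v)` (`u ∼ v`, `v ∈ Λ ∖ U`, `u ∉ Λ`) and any phase `φ`:
`mainSigned Λ U a φ ≤ doorMass Λ U a + wallMass Λ U a`. -/
theorem stub_signedVisitingBound :
    ∀ (Λ U : Finset HexVertex), hexDomainSimplyConnected Λ → U ⊆ Λ →
      ∀ (u v : HexVertex), hexGraph.Adj u v → v ∈ Λ → v ∉ U → u ∉ Λ → ∀ φ : ℝ,
        mainSigned Λ U s(u, v) φ ≤ doorMass Λ U s(u, v) + wallMass Λ U s(u, v) := by
  intro Λ U hΛ hUΛ u v huv hv hvU hu φ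
  have hvΛ' : v ∈ Λ \ U := Finset.mem_sdiff.2 ⟨hv, hvU⟩
  have ha' : s(u, v) ∈ hexDomainMidEdges (Λ \ U) :=
    ⟨(SimpleGraph.mem_edgeSet hexGraph).2 huv, v, Sym2.mem_mk_right u v, hvΛ'⟩
  -- (1)–(2) the flux identity for `F = F^Λ_a`, `F' = F^{Λ∖U}_a`
  have hident := flux_identity hUΛ
    (satisfiesVertexRelations_of_subset hΛ subset_rfl huv hu hv)
    (satisfiesVertexRelations_of_subset hΛ Finset.sdiff_subset huv hu hvΛ')
  -- (3)–(4) `MAIN(F) − MAIN(F') = d_a · S`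
  have hmain :
      (∑ y ∈ Λ \ U, ∑ w ∈ (HexGreen.nbrs y).filter (fun w => w ∉ Λ),
          HexKernel.term (hexParafermionicObservable Λ s(u, v) hexCriticalFugacity (5 / 8)) y w) -
        (∑ y ∈ Λ \ U, ∑ w ∈ (HexGreen.nbrs y).filter (fun w => w ∉ Λ),
          HexKernel.term (hexParafermionicObservable (Λ \ U) s(u, v) hexCriticalFugacity (5 / 8))
            y w) =
      (hexCenter v - hexCenter u) / 2 *
        ∑ y ∈ Λ \ U, ∑ w ∈ (HexGreen.nbrs y).filter (fun w => w ∉ Λ),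
          ∑ γ : HexMidEdgeSAW Λ s(u, v) s(y, w), if Visits γ U then
            Complex.exp (Complex.I * (3 / 8 : ℂ) * (γ.winding : ℂ)) * (xc : ℂ) ^ γ.length
            else 0 := by
    rw [Finset.mul_sum, ← Finset.sum_sub_distrib]
    refine Finset.sum_congr rfl fun y _ => ?_
    rw [Finset.mul_sum, ← Finset.sum_sub_distrib]
    refine Finset.sum_congr rfl fun w hw' => ?_
    obtain ⟨hwn, hwΛ⟩ := Finset.mem_filter.1 hw'
    have hyw : hexGraph.Adj y w := (HexGreen.mem_nbrs_iff y w).1 hwn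
    rw [HexKernel.term, HexKernel.term, ← mul_sub,
      observable_sub_observable_sdiff ha' hexCriticalFugacity (5 / 8) s(y, w), Finset.mul_sum,
      Finset.mul_sum]
    refine Finset.sum_congr rfl fun γ _ => ?_
    split_ifs with hvis
    · have hne : γ.verts ≠ [] := by
        intro h0; obtain ⟨y', hy', -⟩ := hvis; rw [h0] at hy'; simp at hy'
      exact term_weight_eq huv hu hyw hwΛ γ hne
    · simp
  -- (5a) the signed MAIN mass is the real part of `e^{-iφ} S`
  have hre : mainSigned Λ U s(u, v) φ =
      (Complex.exp (-(φ : ℂ) * Complex.I) *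
        ∑ y ∈ Λ \ U, ∑ w ∈ (HexGreen.nbrs y).filter (fun w => w ∉ Λ),
          ∑ γ : HexMidEdgeSAW Λ s(u, v) s(y, w), if Visits γ U then
            Complex.exp (Complex.I * (3 / 8 : ℂ) * (γ.winding : ℂ)) * (xc : ℂ) ^ γ.length
            else 0).re := by
    rw [mainSigned, Finset.mul_sum, Complex.re_sum]
    refine Finset.sum_congr rfl fun y _ => ?_
    rw [Finset.mul_sum, Complex.re_sum]
    refine Finset.sum_congr rfl fun w _ => ?_
    rw [signedVisitMass, Finset.mul_sum, Complex.re_sum]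
    refine Finset.sum_congr rfl fun γ _ => ?_
    split_ifs
    · rw [← mul_assoc, ← Complex.exp_add,
        show -(φ : ℂ) * Complex.I + Complex.I * (3 / 8 : ℂ) * (γ.winding : ℂ) =
          ((3 / 8 * γ.winding - φ : ℝ) : ℂ) * Complex.I by push_cast; ring,
        ← Complex.ofReal_pow, Complex.re_mul_ofReal, Complex.exp_ofReal_mul_I_re]
    · simp
  -- (5b) DOOR and WALL termwise
  have hdoor : ‖∑ y ∈ Λ \ U, ∑ w ∈ (HexGreen.nbrs y).filter (fun w => w ∈ U),
      HexKernel.term (hexParafermionicObservable (Λ \ U) s(u, v) hexCriticalFugacity (5 / 8))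
        y w‖ ≤ (Real.sqrt 3)⁻¹ / 2 * doorMass Λ U s(u, v) := by
    rw [doorMass, Finset.mul_sum]
    refine (norm_sum_le _ _).trans (Finset.sum_le_sum fun y _ => ?_)
    rw [Finset.mul_sum]
    refine (norm_sum_le _ _).trans (Finset.sum_le_sum fun w hw => ?_)
    exact norm_term_le_zmass _ _ ((HexGreen.mem_nbrs_iff y w).1 (Finset.mem_filter.1 hw).1)
  have hwall : ‖∑ y ∈ U, ∑ w ∈ (HexGreen.nbrs y).filter (fun w => w ∉ Λ),
      HexKernel.term (hexParafermionicObservable Λ s(u, v) hexCriticalFugacity (5 / 8)) y w‖ ≤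
        (Real.sqrt 3)⁻¹ / 2 * wallMass Λ U s(u, v) := by
    rw [wallMass, Finset.mul_sum]
    refine (norm_sum_le _ _).trans (Finset.sum_le_sum fun y _ => ?_)
    rw [Finset.mul_sum]
    refine (norm_sum_le _ _).trans (Finset.sum_le_sum fun w hw => ?_)
    exact norm_term_le_zmass _ _ ((HexGreen.mem_nbrs_iff y w).1 (Finset.mem_filter.1 hw).1)
  -- (5c) combine
  have hdn : ‖(hexCenter v - hexCenter u) / 2‖ = (Real.sqrt 3)⁻¹ / 2 := by
    rw [norm_div, norm_hexCenter_sub_of_adj huv]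
    simp
  have hρ : (0 : ℝ) < (Real.sqrt 3)⁻¹ / 2 := by positivity
  have hS : ‖∑ y ∈ Λ \ U, ∑ w ∈ (HexGreen.nbrs y).filter (fun w => w ∉ Λ),
      ∑ γ : HexMidEdgeSAW Λ s(u, v) s(y, w), if Visits γ U then
        Complex.exp (Complex.I * (3 / 8 : ℂ) * (γ.winding : ℂ)) * (xc : ℂ) ^ γ.length
        else 0‖ ≤ doorMass Λ U s(u, v) + wallMass Λ U s(u, v) := by
    have h1 := congrArg (fun z : ℂ => ‖z‖) (hmain.symm.trans hident)
    simp only [norm_mul, hdn] at h1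
    have h2 : (Real.sqrt 3)⁻¹ / 2 * ‖∑ y ∈ Λ \ U, ∑ w ∈ (HexGreen.nbrs y).filter (fun w => w ∉ Λ),
        ∑ γ : HexMidEdgeSAW Λ s(u, v) s(y, w), if Visits γ U then
          Complex.exp (Complex.I * (3 / 8 : ℂ) * (γ.winding : ℂ)) * (xc : ℂ) ^ γ.length
          else 0‖ ≤
        (Real.sqrt 3)⁻¹ / 2 * (doorMass Λ U s(u, v) + wallMass Λ U s(u, v)) := by
      rw [h1, mul_add]
      exact (norm_sub_le _ _).trans (add_le_add hdoor hwall)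
    exact le_of_mul_le_mul_left h2 hρ
  calc mainSigned Λ U s(u, v) φ = _ := hre
    _ ≤ _ := Complex.re_le_norm _
    _ = _ := by
      rw [norm_mul, show -(φ : ℂ) * Complex.I = ((-φ : ℝ) : ℂ) * Complex.I by push_cast; ring,
        Complex.norm_exp_ofReal_mul_I, one_mul]
    _ ≤ doorMass Λ U s(u, v) + wallMass Λ U s(u, v) := hS

end Summit.CriticalPhenomena.SAWScalingLimit.Theorems.HexTight.SumRule
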